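import Summits.CriticalPhenomena.CardyFormulaZ2.Theorems.CardyBoundaryCoulombGasBoundaryDefectGaussianRStubClusterLocalityV2Part2

/-!
# Stub `stub_clusterLocalityV2` of line `rainbow-monomials-in-excursion-kernels` — Part 3:
# uniform decay of the Green function away from a flat boundary point
# (crux `BoundaryDefectGaussianR`, stmt-CriticalPhenomena-14132)

Step (B) of the Green-locality half G1 of `stub_clusterLocalityV2`. Let `V ⊆ ℤ²` be finite and
FLAT at scale `8N` around a point `y` of its bottom row: the half-box
`Q = {|v₀ - y₀| ≤ 8N, y₁ ≤ v₁ ≤ y₁ + 8N}` lies in `V` and the row `y₁ - 1` below it lies outside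
`V` (nothing is assumed about `V` elsewhere). Then the Green function with pole `y` is uniformly
small off the half-box of size `N`:

  `G_V(z, y) ≤ 24/N` for every `z ∉ Q_N = {|v₀ - y₀| ≤ N, y₁ ≤ v₁ ≤ y₁ + N}` (`N ≥ 3`)

(`dirichletGreen_decay`, registered sub-goal `s10_greenDecay`). This is the lattice version of
"the Poisson kernel of a boundary point is `O(1/dist)`", uniformly in the domain beyond the
flat ball. Proof (two-scale maximum principle): let `S = max_{V ∖ Q_N} G_V(·, y)`; by the
maximum principle on `V ∖ Q_N` it is attained next to a rim point `w` of `Q_N`; Green's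
representation of the harmonic `G_V(·,y)` on `Q ∖ {y}` bounds `G_V(w,y)` by the harmonic measure
of `y` from `w` in `Q ∖ {y}` — at most `12/N` by comparison with the half-plane Poisson kernel
(Part 2: `dirichletGreen_le_hpPoisson`, `hpK ≤ 2/s`, `hpK ≤ 2s/(πm²)`) — plus `S` times the
harmonic measure of the far sides of `Q`, at most `1/2` (Part 1: side barrier); so
`S ≤ 12/N + S/2`.

All statements are folklore (Lawler–Limic 2010, §6.2, §8.1).
-/

noncomputable section

namespace Summit.CriticalPhenomena.CardyFormulaZ2.Cruxes.BoundaryDefectGaussianR.RainbowMonomialsInExcursionKernels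

open Finset Literature.Probability.LatticeModels

/-! ### Small lemmas on the planar Green function -/

/-- The Poisson kernel of a point `p ∉ Λ` written out with the four neighbours of `p`.
[folklore] -/
theorem poissonKernel_eq_sum_four {Λ : Finset (Site 2)} (w : Site 2) {p : Site 2} (hp : p ∉ Λ) :
    poissonKernel Λ w p = dirichletGreen Λ w (p + Pi.single 0 1) +
      dirichletGreen Λ w (p - Pi.single 0 1) +
      (dirichletGreen Λ w (p + Pi.single 1 1) + dirichletGreen Λ w (p - Pi.single 1 1)) := by
  rw [poissonKernel, if_neg hp, sum_neighborFinset_zdGraph, Fin.sum_univ_two]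

/-- The Poisson equation at the pole, written out: for `p ∈ Λ` and `w ≠ p`,
`G(w, p+e₁) + G(w, p-e₁) + G(w, p+e₂) + G(w, p-e₂) = 4 G(w, p)`. [folklore] -/
theorem sum_four_dirichletGreen_eq {Λ : Finset (Site 2)} {w p : Site 2} (hp : p ∈ Λ) (hwp : w ≠ p) :
    dirichletGreen Λ w (p + Pi.single 0 1) + dirichletGreen Λ w (p - Pi.single 0 1) +
      (dirichletGreen Λ w (p + Pi.single 1 1) + dirichletGreen Λ w (p - Pi.single 1 1)) =
      4 * dirichletGreen Λ w p := by
  have hd : 0 < 2 := by norm_num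
  have h := sum_neighborFinset_dirichletGreen hd Λ w hp
  rw [if_neg hwp, sum_neighborFinset_zdGraph, Fin.sum_univ_two] at h
  push_cast at h
  linarith

/-- **`G_V(y, y) ≤ 1` at a point whose lower neighbour is outside `V`** (the walk at `y` is
killed at its next step with probability `≥ 1/4`; in the tree's normalisation `G = (4 - A)⁻¹`):
`4 G(y,y) - 1 = ∑_{w ∼ y} G(y, w) ≤ 3 G(y, y)`. [folklore] -/
theorem dirichletGreen_diag_le_one {V : Finset (Site 2)} {y : Site 2}
    (hy' : y - Pi.single 1 1 ∉ V) : dirichletGreen V y y ≤ 1 := by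
  have hd : 0 < 2 := by norm_num
  by_cases hy : y ∈ V
  · have h := sum_neighborFinset_dirichletGreen hd V y hy
    rw [if_pos rfl, sum_neighborFinset_zdGraph, Fin.sum_univ_two] at h
    have h0 : dirichletGreen V y (y - Pi.single 1 1) = 0 :=
      dirichletGreen_of_not_mem_right V y hy'
    have hle : ∀ w, dirichletGreen V y w ≤ dirichletGreen V y y := fun w => by
      rw [dirichletGreen_comm V y w]; exact dirichletGreen_le_diag hd V w y
    have h1 := hle (y + Pi.single 0 1)
    have h2 := hle (y - Pi.single 0 1)
    have h3 := hle (y + Pi.single 1 1)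
    push_cast at h
    linarith
  · rw [dirichletGreen_of_not_mem_left V hy]; exact zero_le_one

/-- **The half-plane kernel on the rim of the half-box of size `N`** (and one step sideways):
if `|u₀| ≥ N - 1` and `0 ≤ u₁ ≤ N`, or `u₁ = N`, then `hpPoisson u ≤ 2/N` (`N ≥ 3`; the tree's
`hpPoisson (m, j) ≤ 2(j+1)/(π m²)` on the sides, Part 2's `≤ 2/(j+1)` on the top). [folklore] -/
theorem hpPoisson_le_two_div_of_rim {N : ℕ} (hN : 3 ≤ N) {u : Site 2}
    (hu : ((N : ℤ) - 1 ≤ |u 0| ∧ 0 ≤ u 1 ∧ u 1 ≤ N) ∨ u 1 = N) : hpPoisson u ≤ 2 / N := by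
  have hNr : (3 : ℝ) ≤ N := by exact_mod_cast hN
  have hN0 : (0 : ℝ) < N := by linarith
  rcases hu with ⟨h0, h1, h1'⟩ | htop
  · have hu0 : u 0 ≠ 0 := by
      intro h; rw [h, abs_zero] at h0; omega
    have hle := hpPoisson_le u hu0 (by omega)
    have hsq : ((N : ℝ) - 1) ^ 2 ≤ ((u 0 : ℤ) : ℝ) ^ 2 := by
      have habs : (N : ℝ) - 1 ≤ |((u 0 : ℤ) : ℝ)| := by
        rw [← Int.cast_abs]; exact_mod_cast h0
      have hN1 : (0 : ℝ) ≤ (N : ℝ) - 1 := by linarith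
      nlinarith [abs_nonneg (((u 0 : ℤ) : ℝ)), sq_abs (((u 0 : ℤ) : ℝ))]
    have hu1 : ((u 1 : ℤ) : ℝ) + 1 ≤ (N : ℝ) + 1 := by
      have : ((u 1 : ℤ) : ℝ) ≤ N := by exact_mod_cast h1'
      linarith
    have hu1' : (0 : ℝ) ≤ ((u 1 : ℤ) : ℝ) + 1 := by
      have : (0 : ℝ) ≤ ((u 1 : ℤ) : ℝ) := by exact_mod_cast h1
      linarith
    have hπ := Real.pi_gt_three
    have hpos : (0 : ℝ) < ((N : ℝ) - 1) ^ 2 := by nlinarith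
    calc hpPoisson u ≤ 2 * (((u 1 : ℤ) : ℝ) + 1) / (Real.pi * ((u 0 : ℤ) : ℝ) ^ 2) := hle
      _ ≤ 2 * ((N : ℝ) + 1) / (3 * ((N : ℝ) - 1) ^ 2) := by
          have hden : (0 : ℝ) < 3 * ((N : ℝ) - 1) ^ 2 := by positivity
          have hden' : 3 * ((N : ℝ) - 1) ^ 2 ≤ Real.pi * ((u 0 : ℤ) : ℝ) ^ 2 := by nlinarith
          calc 2 * (((u 1 : ℤ) : ℝ) + 1) / (Real.pi * ((u 0 : ℤ) : ℝ) ^ 2)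
              ≤ 2 * ((N : ℝ) + 1) / (Real.pi * ((u 0 : ℤ) : ℝ) ^ 2) :=
                div_le_div_of_nonneg_right (by linarith) (by positivity)
            _ ≤ 2 * ((N : ℝ) + 1) / (3 * ((N : ℝ) - 1) ^ 2) :=
                div_le_div_of_nonneg_left (by positivity) hden hden'
      _ ≤ 2 / N := by
          rw [div_le_div_iff₀ (by positivity) hN0]
          nlinarith
  · have h := hpPoisson_le_two_div u (by omega)
    have e : ((u 1 : ℤ) : ℝ) + 1 = (N : ℝ) + 1 := by rw [htop]; push_cast; ring
    rw [e] at h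
    exact h.trans (div_le_div_of_nonneg_left (by norm_num) hN0 (by linarith))

/-! ### The harmonic measure of the pole from the rim -/

/-- **From a rim point of the half-box of size `N`, the harmonic measure of the pole `y` inside
`Q ∖ {y}` is `≤ 12/N`**, `Q` the half-box of size `8N` at `y`: the three live neighbours of `y`
contribute `G_Q(w, y ± e₁) ≤ hpPoisson(w - y ∓ e₁)` and `G_Q(w, y + e₂) ≤ 4 G_Q(w, y) ≤
4 hpPoisson(w - y)`, each kernel value being `≤ 2/N` on the rim. [folklore] -/
theorem poissonKernel_erase_pole_le {Q : Finset (Site 2)} {y : Site 2} {N : ℕ} (hN : 3 ≤ N)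
    (hQ : ∀ v : Site 2, v ∈ Q ↔ (y 0 - (8 * N : ℕ) ≤ v 0 ∧ v 0 ≤ y 0 + (8 * N : ℕ)) ∧
      (y 1 ≤ v 1 ∧ v 1 ≤ y 1 + (8 * N : ℕ)))
    {w : Site 2} (hw1 : y 1 ≤ w 1 ∧ w 1 ≤ y 1 + N) (hw0 : y 0 - N ≤ w 0 ∧ w 0 ≤ y 0 + N)
    (hrim : w 0 = y 0 - N ∨ w 0 = y 0 + N ∨ w 1 = y 1 + N) :
    poissonKernel (Q.erase y) w y ≤ 12 / N := by
  have hd : 0 < 2 := by norm_num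
  have hyQ : y ∈ Q := self_mem_halfRect hQ
  have hwy : w ≠ y := by rintro rfl; omega
  have hΛQ : Q.erase y ⊆ Q := Finset.erase_subset y Q
  have hrows : ∀ p : Site 2, p 1 = y 1 → ∀ v ∈ Q, p 1 ≤ v 1 := fun p hp v hv => by
    rw [hQ] at hv; omega
  rw [poissonKernel_eq_sum_four w (Finset.notMem_erase y Q)]
  obtain ⟨⟨a0, a1⟩, ⟨b0, b1⟩, ⟨c0, c1⟩, ⟨d0, d1⟩⟩ := neighbour_coords y
  -- the lower neighbour is outside `Q`
  have h4 : dirichletGreen (Q.erase y) w (y - Pi.single 1 1) = 0 :=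
    dirichletGreen_of_not_mem_right _ w fun h => by
      have := (Finset.mem_erase.1 h).2; rw [hQ] at this; omega
  -- the three live neighbours, compared in `Q` with the half-plane kernel
  have m1 := dirichletGreen_mono hd hΛQ w (y + Pi.single 0 1)
  have m2 := dirichletGreen_mono hd hΛQ w (y - Pi.single 0 1)
  have m3 := dirichletGreen_mono hd hΛQ w (y + Pi.single 1 1)
  have k1 := dirichletGreen_le_hpPoisson (hrows (y + Pi.single 0 1) a1) w
  have k2 := dirichletGreen_le_hpPoisson (hrows (y - Pi.single 0 1) b1) w
  have k0 := dirichletGreen_le_hpPoisson (hrows y rfl) w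
  have hsum := sum_four_dirichletGreen_eq hyQ hwy
  have g1 := dirichletGreen_nonneg hd Q w (y + Pi.single 0 1)
  have g2 := dirichletGreen_nonneg hd Q w (y - Pi.single 0 1)
  have g4 := dirichletGreen_nonneg hd Q w (y - Pi.single 1 1)
  have k3 : dirichletGreen Q w (y + Pi.single 1 1) ≤ 4 * hpPoisson (w - y) := by linarith
  -- the kernel values on the rim
  have hNz : (N : ℤ) = ((N : ℕ) : ℤ) := rfl
  have r0 : hpPoisson (w - y) ≤ 2 / N := by
    refine hpPoisson_le_two_div_of_rim hN ?_
    simp only [Pi.sub_apply]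
    rcases hrim with h | h | h
    · left; refine ⟨?_, by omega, by omega⟩; rw [abs_of_nonpos (by omega)]; omega
    · left; refine ⟨?_, by omega, by omega⟩; rw [abs_of_nonneg (by omega)]; omega
    · right; omega
  have r1 : hpPoisson (w - (y + Pi.single 0 1)) ≤ 2 / N := by
    refine hpPoisson_le_two_div_of_rim hN ?_
    simp only [Pi.sub_apply, a0, a1]
    rcases hrim with h | h | h
    · left; refine ⟨?_, by omega, by omega⟩; rw [abs_of_nonpos (by omega)]; omega
    · left; refine ⟨?_, by omega, by omega⟩; rw [abs_of_nonneg (by omega)]; omega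
    · right; omega
  have r2 : hpPoisson (w - (y - Pi.single 0 1)) ≤ 2 / N := by
    refine hpPoisson_le_two_div_of_rim hN ?_
    simp only [Pi.sub_apply, b0, b1]
    rcases hrim with h | h | h
    · left; refine ⟨?_, by omega, by omega⟩; rw [abs_of_nonpos (by omega)]; omega
    · left; refine ⟨?_, by omega, by omega⟩; rw [abs_of_nonneg (by omega)]; omega
    · right; omega
  have e : (12 : ℝ) / N = 2 / N + 2 / N + 4 * (2 / N) := by ring
  rw [e, h4, add_zero]
  linarith

/-! ### (B) Uniform decay -/

/-- **(B) Uniform decay of the Green function away from a flat boundary point.** Let `N ≥ 3`,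
let the half-box `{|v₀ - y₀| ≤ 8N, y₁ ≤ v₁ ≤ y₁ + 8N}` lie in `V` and the row below it
(`v₁ = y₁ - 1`, `|v₀ - y₀| ≤ 8N`) lie outside `V`. Then `G_V(z, y) ≤ 24/N` for every `z` off
the half-box of size `N` at `y` — whatever `V` is elsewhere. [folklore] -/
theorem dirichletGreen_decay {V : Finset (Site 2)} {y : Site 2} {N : ℕ} (hN : 3 ≤ N)
    (hin : ∀ v : Site 2, y 0 - 8 * N ≤ v 0 → v 0 ≤ y 0 + 8 * N → y 1 ≤ v 1 →
      v 1 ≤ y 1 + 8 * N → v ∈ V)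
    (hout : ∀ v : Site 2, y 0 - 8 * N ≤ v 0 → v 0 ≤ y 0 + 8 * N → v 1 = y 1 - 1 → v ∉ V)
    {z : Site 2} (hz : ¬ ((y 0 - N ≤ z 0 ∧ z 0 ≤ y 0 + N) ∧ (y 1 ≤ z 1 ∧ z 1 ≤ y 1 + N))) :
    dirichletGreen V z y ≤ 24 / N := by
  have hd : 0 < 2 := by norm_num
  have hN1 : 1 ≤ N := by omega
  have hNpos : (0 : ℝ) < N := by exact_mod_cast (show 0 < N by omega)
  -- the big half-box `Q = Q_{8N}` and `Λ = Q ∖ {y}`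
  obtain ⟨Q, hQ⟩ := exists_halfRect y (8 * N) (8 * N)
  have hQV : Q ⊆ V := fun v hv => by
    rw [hQ] at hv; push_cast at hv; exact hin v hv.1.1 hv.1.2 hv.2.1 hv.2.2
  have hyQ : y ∈ Q := self_mem_halfRect hQ
  have hy' : y - Pi.single 1 1 ∉ V := hout _ (by simp) (by simp) (by simp)
  set Λ := Q.erase y with hΛdef
  have hΛQ : Λ ⊆ Q := Finset.erase_subset y Q
  -- `h = G_V(·, y)`: nonnegative, zero off `V`, harmonic on `V ∖ {y}`, `h y ≤ 1`
  set h : Site 2 → ℝ := fun w => dirichletGreen V w y with hh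
  have h_eq : h = dirichletGreen V y := by funext w; exact dirichletGreen_comm V w y
  have h_nonneg : ∀ w, 0 ≤ h w := fun w => dirichletGreen_nonneg hd V w y
  have h_zero : ∀ w ∉ V, h w = 0 := fun w hw => dirichletGreen_of_not_mem_left V hw y
  have h_harm : ∀ w ∈ V, w ≠ y → latticeLaplacianZd h w = 0 := fun w hw hwy => by
    rw [h_eq]
    have := neg_latticeLaplacianZd_dirichletGreen hd V y hw
    rw [if_neg (Ne.symm hwy)] at this
    linarith
  have hy1 : h y ≤ 1 := dirichletGreen_diag_le_one hy'
  -- trivial off `V`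
  by_cases hzV : z ∈ V
  swap
  · show h z ≤ 24 / N
    rw [h_zero z hzV]; positivity
  -- the exceptional set `T = V ∖ Q_N` and the maximum `S` of `h` on it
  set T := V.filter (fun v => ¬ ((y 0 - N ≤ v 0 ∧ v 0 ≤ y 0 + N) ∧
    (y 1 ≤ v 1 ∧ v 1 ≤ y 1 + N))) with hT
  have hzT : z ∈ T := Finset.mem_filter.2 ⟨hzV, hz⟩
  obtain ⟨z₀, hz₀T, hz₀max⟩ := T.exists_max_image h ⟨z, hzT⟩
  set S := h z₀ with hS
  have hS0 : 0 ≤ S := h_nonneg z₀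
  have hST : ∀ w, ¬ ((y 0 - N ≤ w 0 ∧ w 0 ≤ y 0 + N) ∧ (y 1 ≤ w 1 ∧ w 1 ≤ y 1 + N)) →
      h w ≤ S := by
    intro w hw
    by_cases hwV : w ∈ V
    · exact hz₀max w (Finset.mem_filter.2 ⟨hwV, hw⟩)
    · rw [h_zero w hwV]; exact hS0
  suffices hmain : S ≤ 24 / N from (hz₀max z hzT).trans hmain
  -- the side barrier of `Q`
  set q : Site 2 → ℝ := fun v => (((v 1 - y 1 : ℤ) : ℝ) + 1) / (((8 * N : ℕ) : ℝ) + 2) +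
    (((v 0 - y 0 : ℤ) : ℝ) ^ 2 + (((v 1 - y 1 : ℤ) : ℝ) + 1) *
      (((8 * N : ℕ) : ℝ) + 1 - ((v 1 - y 1 : ℤ) : ℝ))) / (((8 * N : ℕ) : ℝ) + 1) ^ 2 with hqdef
  have hq : ∀ v : Site 2, q v = (((v 1 - y 1 : ℤ) : ℝ) + 1) / (((8 * N : ℕ) : ℝ) + 2) +
    (((v 0 - y 0 : ℤ) : ℝ) ^ 2 + (((v 1 - y 1 : ℤ) : ℝ) + 1) *
      (((8 * N : ℕ) : ℝ) + 1 - ((v 1 - y 1 : ℤ) : ℝ))) / (((8 * N : ℕ) : ℝ) + 1) ^ 2 :=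
    fun v => rfl
  -- Step 1: the rim bound `h w ≤ 12/N + S/2`
  have hrim : ∀ w : Site 2, ((y 0 - N ≤ w 0 ∧ w 0 ≤ y 0 + N) ∧ (y 1 ≤ w 1 ∧ w 1 ≤ y 1 + N)) →
      (w 0 = y 0 - N ∨ w 0 = y 0 + N ∨ w 1 = y 1 + N) → h w ≤ 12 / N + S / 2 := by
    intro w hwN hwrim
    have hwy : w ≠ y := by rintro rfl; omega
    have hwQ : w ∈ Q := by rw [hQ]; push_cast; omega
    have hwΛ : w ∈ Λ := Finset.mem_erase.2 ⟨hwy, hwQ⟩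
    -- Green's representation of `h` on `Λ`
    have hrep := green_representation hd Λ h hwΛ
    have hvol : ∑ v ∈ Λ, dirichletGreen Λ w v * (-latticeLaplacianZd h v) = 0 := by
      refine Finset.sum_eq_zero fun v hv => ?_
      have hv' := Finset.mem_erase.1 hv
      rw [h_harm v (hQV hv'.2) hv'.1, neg_zero, mul_zero]
    rw [hvol, zero_add] at hrep
    -- pointwise bound of the boundary terms
    have hpt : ∀ b ∈ outerBoundary (zdGraph 2) Λ, poissonKernel Λ w b * h b ≤
        (if b = y then poissonKernel Λ w b else 0) +
          S * (if y 1 ≤ b 1 ∧ b ≠ y then poissonKernel Λ w b else 0) := by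
      intro b hb
      have hH := poissonKernel_nonneg hd Λ w b
      rcases outerBoundary_erase_subset hb with hby | hbQ
      · subst hby
        rw [if_pos rfl, if_neg (fun h => h.2 rfl), mul_zero, add_zero]
        calc poissonKernel Λ w b * h b ≤ poissonKernel Λ w b * 1 := by gcongr
          _ = poissonKernel Λ w b := mul_one _
      · have hby : b ≠ y := fun h => (mem_outerBoundary_iff.1 hbQ).1 (h ▸ hyQ)
        rw [if_neg hby, zero_add]
        rcases outerBoundary_halfRect hQ hbQ with hbot | hfar | hfar
        · -- bottom row: outside `V`
          have hbV : b ∉ V := hout b (by push_cast at hbot; omega) (by push_cast at hbot; omega)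
            hbot.1
          rw [h_zero b hbV, mul_zero]
          split_ifs <;> nlinarith
        · rw [if_pos ⟨by omega, hby⟩, mul_comm]
          exact mul_le_mul_of_nonneg_right (hST b (by push_cast at hfar; omega)) hH
        · rw [if_pos ⟨by omega, hby⟩, mul_comm]
          exact mul_le_mul_of_nonneg_right (hST b (by push_cast at hfar; omega)) hH
    have hsum1 : ∑ b ∈ outerBoundary (zdGraph 2) Λ, (if b = y then poissonKernel Λ w b else 0) ≤
        poissonKernel Λ w y := by
      rw [Finset.sum_ite_eq']
      split_ifs
      · exact le_rfl
      · exact poissonKernel_nonneg hd Λ w y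
    have hsum2 : ∑ b ∈ outerBoundary (zdGraph 2) Λ,
        (if y 1 ≤ b 1 ∧ b ≠ y then poissonKernel Λ w b else 0) ≤ 1 / 2 := by
      rw [← Finset.sum_filter]
      calc ∑ b ∈ (outerBoundary (zdGraph 2) Λ).filter (fun b => y 1 ≤ b 1 ∧ b ≠ y),
            poissonKernel Λ w b
          ≤ ∑ b ∈ (outerBoundary (zdGraph 2) Q).filter (fun b => y 1 ≤ b 1),
              poissonKernel Λ w b := by
            refine Finset.sum_le_sum_of_subset_of_nonneg (fun b hb => ?_)
              fun b _ _ => poissonKernel_nonneg hd Λ w b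
            rw [Finset.mem_filter] at hb ⊢
            rcases outerBoundary_erase_subset hb.1 with h' | h'
            · exact absurd h' hb.2.2
            · exact ⟨h', hb.2.1⟩
        _ ≤ q w := sum_poissonKernel_far_le_of hQ hq hΛQ
            (fun b hb => (outerBoundary_erase_subset hb).elim (fun h' => Or.inl (h' ▸ hyQ)) Or.inr)
            hwΛ
        _ ≤ 1 / 2 := sideBarrier_le_half hq hN1 le_rfl (by omega) (by omega)
    have hpole : poissonKernel Λ w y ≤ 12 / N :=
      poissonKernel_erase_pole_le hN hQ hwN.2 hwN.1 hwrim
    calc h w = ∑ b ∈ outerBoundary (zdGraph 2) Λ, poissonKernel Λ w b * h b := hrep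
      _ ≤ ∑ b ∈ outerBoundary (zdGraph 2) Λ, ((if b = y then poissonKernel Λ w b else 0) +
          S * (if y 1 ≤ b 1 ∧ b ≠ y then poissonKernel Λ w b else 0)) := Finset.sum_le_sum hpt
      _ = ∑ b ∈ outerBoundary (zdGraph 2) Λ, (if b = y then poissonKernel Λ w b else 0) +
          S * ∑ b ∈ outerBoundary (zdGraph 2) Λ,
            (if y 1 ≤ b 1 ∧ b ≠ y then poissonKernel Λ w b else 0) := by
          rw [Finset.sum_add_distrib, Finset.mul_sum]
      _ ≤ 12 / N + S * (1 / 2) := add_le_add (hsum1.trans hpole) (by gcongr)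
      _ = 12 / N + S / 2 := by ring
  -- Step 2: maximum principle on `T`
  have hTfin : (↑T : Set (Site 2)).Finite := T.finite_toSet
  have hsub : IsZdSubharmonicOn h ↑T := by
    intro w hw
    have hw' := Finset.mem_filter.1 (Finset.mem_coe.1 hw)
    have hwy : w ≠ y := by rintro rfl; exact hw'.2 ⟨by omega, by omega⟩
    exact (h_harm w hw'.1 hwy).ge
  have hbd : ∀ b ∈ zdOuterBoundary (↑T : Set (Site 2)), h b ≤ 12 / N + S / 2 := by
    intro b hb
    obtain ⟨hbT, x, hx, hadj⟩ := mem_outerBoundary_iff.1 (mem_outerBoundary_of_mem_zdOuterBoundary hb)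
    have hx' := Finset.mem_filter.1 hx
    by_cases hbV : b ∈ V
    swap
    · rw [h_zero b hbV]; positivity
    have hbN : (y 0 - N ≤ b 0 ∧ b 0 ≤ y 0 + N) ∧ (y 1 ≤ b 1 ∧ b 1 ≤ y 1 + N) := by
      by_contra hcon
      exact hbT (Finset.mem_filter.2 ⟨hbV, hcon⟩)
    refine hrim b hbN ?_
    have hxN := hx'.2
    rcases (adj_iff_coords b x).1 hadj with hc | hc | hc | hc
    · omega
    · omega
    · omega
    · -- `x = b - e₂`: `x` is below `b`; then `b` is on the row and `x` is outside `V`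
      exfalso
      have hx1 : x 1 = y 1 - 1 := by omega
      exact hout x (by omega) (by omega) hx1 hx'.1
  have key := hsub.le_of_forall_boundary_le hd hTfin hbd z₀ (Finset.mem_coe.2 hz₀T)
  -- `S ≤ 12/N + S/2`
  have : S ≤ 12 / N + S / 2 := key
  have e : (24 : ℝ) / N = 2 * (12 / N) := by ring
  rw [e]; linarith

/-! ### Registered sub-goal of the stub carried by this file -/

/-- **Sub-goal `s10_greenDecay`** (registered on stmt-CriticalPhenomena-14132; step (B) of the
Green-locality half G1 of `stub_clusterLocalityV2`): uniform decay `G_V(z, y) ≤ 24/N` of the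
Dirichlet Green function with pole at a flat bottom-row point `y`, off the half-box of size `N`,
for every finite `V` containing the half-box of size `8N` at `y` and missing the row below it
(`dirichletGreen_decay`). [folklore] -/
theorem s10_greenDecay : ∀ (V : Finset (Literature.Probability.LatticeModels.Site 2)) (y : Literature.Probability.LatticeModels.Site 2) (N : ℕ), 3 ≤ N → (∀ v : Literature.Probability.LatticeModels.Site 2, y 0 - 8 * N ≤ v 0 → v 0 ≤ y 0 + 8 * N → y 1 ≤ v 1 → v 1 ≤ y 1 + 8 * N → v ∈ V) → (∀ v : Literature.Probability.LatticeModels.Site 2, y 0 - 8 * N ≤ v 0 → v 0 ≤ y 0 + 8 * N → v 1 = y 1 - 1 → v ∉ V) → ∀ z : Literature.Probability.LatticeModels.Site 2, ¬ ((y 0 - N ≤ z 0 ∧ z 0 ≤ y 0 + N) ∧ (y 1 ≤ z 1 ∧ z 1 ≤ y 1 + N)) → Literature.Probability.LatticeModels.dirichletGreen V z y ≤ 24 / (N : ℝ) :=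
  fun _ _ _ hN hin hout _ hz => dirichletGreen_decay hN hin hout hz

end Summit.CriticalPhenomena.CardyFormulaZ2.Cruxes.BoundaryDefectGaussianR.RainbowMonomialsInExcursionKernels

end
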